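import Mathlib
import Summits.Ventures.PercRepro2.TwoHullMasterPathPendantCover

/-!
# Keyed cube blocks (blind cell PercRepro2, night-4 g40, 2026-08-29; proofs/NIGHT4-G40.md §15)

A KEYED BLOCK records, beside the monotone cube block, what a pendant graph needs: an INTERFACE
BIT `sbit` (monotone along the cube, negated at the antipode) and a classification of the vertices
other than `h` into `Before` (never in the hull of `h` on the block), `After` (never in the hull of
`l`) and `At` (red for `l` only when the bit is set, blue for `l` only when it is clear, red for `h`
only when it is clear, blue for `h` only when it is set).  The blocks of the path cover are keyed
(`keyedBlock_keyWord`, `keyedBlock_sentWord`: `Before` = the vertices up to the key vertex, `At` =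
the key vertex, `After` = the rest), and TwoHullMasterKeyedPend.lean shows that a pendant graph at
any vertex of `Before ∪ At ∪ After` keeps a keyed cover keyed — the pendant's vertices inherit the
class of the attaching vertex — so that the cube-cover conjecture holds on every path decorated
with arbitrary graphs at its vertices (all trees among them), in the kernel.
-/

namespace Summit.Ventures.PercRepro2

namespace Blocks

open Hull LocRows Path2 Glue Glue2

open scoped Classical

variable {V : Type*} {E : Type*}

/-- **A keyed block.** -/
structure KeyedBlock (ends : E → Sym2 V) (l h : V) {ι : Type*} (pt : (ι → Bool) → Config E)
    (sbit : (ι → Bool) → Bool) (Before At After : Set V) : Prop where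
  /-- The underlying monotone cube block. -/
  block : CubeBlock ends l h pt
  /-- The interface bit is monotone. -/
  sbit_mono : ∀ ⦃ε ε' : ι → Bool⦄, ε ≤ ε' → sbit ε ≤ sbit ε'
  /-- The interface bit is negated at the antipode. -/
  sbit_not : ∀ ε, sbit (cubeNot ε) = !sbit ε
  /-- A vertex before the key is never in the hull of `h`. -/
  before : ∀ x ∈ Before, ∀ ε, x ∉ (hullPair ends (pt ε) h).1 ∧ x ∉ (hullPair ends (pt ε) h).2
  /-- A vertex after the key is never in the hull of `l`. -/
  after : ∀ x ∈ After, ∀ ε, x ∉ (hullPair ends (pt ε) l).1 ∧ x ∉ (hullPair ends (pt ε) l).2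
  /-- A key vertex is red for `l` only when the bit is set. -/
  at_l_red : ∀ x ∈ At, ∀ ε, sbit ε = false → x ∉ (hullPair ends (pt ε) l).1
  /-- A key vertex is blue for `l` only when the bit is clear. -/
  at_l_blue : ∀ x ∈ At, ∀ ε, sbit ε = true → x ∉ (hullPair ends (pt ε) l).2
  /-- A key vertex is red for `h` only when the bit is clear. -/
  at_h_red : ∀ x ∈ At, ∀ ε, sbit ε = true → x ∉ (hullPair ends (pt ε) h).1
  /-- A key vertex is blue for `h` only when the bit is set. -/
  at_h_blue : ∀ x ∈ At, ∀ ε, sbit ε = false → x ∉ (hullPair ends (pt ε) h).2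

/-- **A keyed cover**: a cube cover all of whose blocks are keyed. -/
structure KeyedCover (ends : E → Sym2 V) (l h : V) {β : Type*} {ι : β → Type*}
    (pt : ∀ b, (ι b → Bool) → Config E) (sbit : ∀ b, (ι b → Bool) → Bool)
    (Before At After : β → Set V) : Prop where
  /-- The underlying cover. -/
  cover : CubeCover ends l h pt
  /-- Every block is keyed. -/
  keyed : ∀ b, KeyedBlock ends l h (pt b) (sbit b) (Before b) (At b) (After b)

/-! ## The path cover is keyed -/

variable {k : ℕ} {p : Fin (k + 3) → V}

/-- The classes of the block of key `i`: before = the vertices up to `p (i + 1)`… -/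
def pathBefore (p : Fin (k + 3) → V) : Fin k ⊕ Unit → Set V
  | Sum.inl i => {x | ∃ v : Fin (k + 3), x = p v ∧ v.val ≤ i.val}
  | Sum.inr _ => {x | ∃ v : Fin (k + 3), x = p v ∧ v.val ≤ k}

/-- The key vertex of a block. -/
def pathAt (p : Fin (k + 3) → V) : Fin k ⊕ Unit → Set V
  | Sum.inl i => {x | ∃ v : Fin (k + 3), x = p v ∧ v.val = i.val + 1}
  | Sum.inr _ => {x | ∃ v : Fin (k + 3), x = p v ∧ v.val = k + 1}

/-- The vertices after the key vertex (other than `h`). -/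
def pathAfter (p : Fin (k + 3) → V) : Fin k ⊕ Unit → Set V
  | Sum.inl i => {x | ∃ v : Fin (k + 3), x = p v ∧ i.val + 2 ≤ v.val ∧ v.val ≤ k + 1}
  | Sum.inr _ => ∅

/-- The interface bit of a path block. -/
lemma sbit_mono_path (b : Fin k ⊕ Unit) {ε ε' : pathι b → Bool} (hle : ε ≤ ε') :
    sbit b ε ≤ sbit b ε' := by
  cases b with
  | inl i => exact hle (Sum.inr false)
  | inr u => exact hle ()

/-- **The blocks of the path cover are keyed.** -/
theorem keyedBlock_path (hp : Function.Injective p) (b : Fin k ⊕ Unit) :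
    KeyedBlock (pathEnds p) (p 0) (p (Fin.last (k + 2))) (pathPt b) (sbit b) (pathBefore p b)
      (pathAt p b) (pathAfter p b) := by
  refine ⟨?_, fun ε ε' hle => sbit_mono_path b hle, fun ε => sbit_cubeNot b ε, ?_, ?_, ?_, ?_, ?_,
    ?_⟩
  · cases b with
    | inl i => exact cubeBlock_keyWord hp i
    | inr u => exact cubeBlock_sentWord hp
  · rintro x hx ε
    cases b with
    | inl i =>
      obtain ⟨v, rfl, hv⟩ := hx
      rw [mem_hullPair_last_fst hp, mem_hullPair_last_snd hp]
      exact ⟨not_suf_keyWord ε true hv, not_suf_keyWord ε false hv⟩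
    | inr u =>
      obtain ⟨v, rfl, hv⟩ := hx
      rw [mem_hullPair_last_fst hp, mem_hullPair_last_snd hp]
      exact ⟨not_suf_sentWord ε true hv, not_suf_sentWord ε false hv⟩
  · rintro x hx ε
    cases b with
    | inl i =>
      obtain ⟨v, rfl, hv, _⟩ := hx
      rw [mem_hullPair_zero_fst hp, mem_hullPair_zero_snd hp]
      exact ⟨not_pre_keyWord ε true (by omega), not_pre_keyWord ε false (by omega)⟩
    | inr u => exact absurd hx (Set.notMem_empty x)
  · rintro x hx ε hs
    cases b with
    | inl i =>
      obtain ⟨v, rfl, hv⟩ := hx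
      rw [mem_hullPair_zero_fst hp]
      intro hP
      have := pre_keyWord_succ hv hP
      simp only [sbit] at hs
      rw [hs] at this; exact absurd this (by decide)
    | inr u =>
      obtain ⟨v, rfl, hv⟩ := hx
      rw [mem_hullPair_zero_fst hp]
      intro hP
      have := pre_sentWord_succ hv hP
      simp only [sbit] at hs
      rw [hs] at this; exact absurd this (by decide)
  · rintro x hx ε hs
    cases b with
    | inl i =>
      obtain ⟨v, rfl, hv⟩ := hx
      rw [mem_hullPair_zero_snd hp]
      intro hP
      have := pre_keyWord_succ hv hP
      simp only [sbit] at hs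
      rw [hs] at this; exact absurd this (by decide)
    | inr u =>
      obtain ⟨v, rfl, hv⟩ := hx
      rw [mem_hullPair_zero_snd hp]
      intro hP
      have := pre_sentWord_succ hv hP
      simp only [sbit] at hs
      rw [hs] at this; exact absurd this (by decide)
  · rintro x hx ε hs
    cases b with
    | inl i =>
      obtain ⟨v, rfl, hv⟩ := hx
      rw [mem_hullPair_last_fst hp]
      intro hS
      have := suf_keyWord_succ hv hS
      simp only [sbit] at hs
      rw [hs] at this; exact absurd this (by decide)
    | inr u =>
      obtain ⟨v, rfl, hv⟩ := hx
      rw [mem_hullPair_last_fst hp]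
      intro hS
      have := suf_sentWord_succ hv hS
      simp only [sbit] at hs
      rw [hs] at this; exact absurd this (by decide)
  · rintro x hx ε hs
    cases b with
    | inl i =>
      obtain ⟨v, rfl, hv⟩ := hx
      rw [mem_hullPair_last_snd hp]
      intro hS
      have := suf_keyWord_succ hv hS
      simp only [sbit] at hs
      rw [hs] at this; exact absurd this (by decide)
    | inr u =>
      obtain ⟨v, rfl, hv⟩ := hx
      rw [mem_hullPair_last_snd hp]
      intro hS
      have := suf_sentWord_succ hv hS
      simp only [sbit] at hs
      rw [hs] at this; exact absurd this (by decide)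

/-- **The path cover is keyed.** -/
theorem keyedCover_path (hp : Function.Injective p) :
    KeyedCover (pathEnds p) (p 0) (p (Fin.last (k + 2))) (pathPt (k := k)) sbit (pathBefore p)
      (pathAt p) (pathAfter p) :=
  ⟨cubeCover_path hp, keyedBlock_path hp⟩

/-- Every vertex of the path other than `h` is classified in every block. -/
lemma path_classified (b : Fin k ⊕ Unit) (v : Fin (k + 3)) (hv : v ≠ Fin.last (k + 2)) :
    p v ∈ pathBefore p b ∨ p v ∈ pathAt p b ∨ p v ∈ pathAfter p b := by
  have hvk : v.val ≤ k + 1 := by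
    have := v.isLt
    have hne : v.val ≠ k + 2 := fun h => hv (Fin.ext h)
    omega
  cases b with
  | inl i =>
    rcases Nat.lt_trichotomy v.val (i.val + 1) with h1 | h1 | h1
    · exact Or.inl ⟨v, rfl, by omega⟩
    · exact Or.inr (Or.inl ⟨v, rfl, h1⟩)
    · exact Or.inr (Or.inr ⟨v, rfl, by omega, hvk⟩)
  | inr u =>
    rcases Nat.lt_or_ge v.val (k + 1) with h1 | h1
    · exact Or.inl ⟨v, rfl, by omega⟩
    · exact Or.inr (Or.inl ⟨v, rfl, by omega⟩)

end Blocks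

end Summit.Ventures.PercRepro2
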